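import Literature.AlgebraicGeometry.Resolution.BlowupExceptionalGenericOrder
import Literature.AlgebraicGeometry.Resolution.ExceptionalDivisorIrreducible
import Literature.AlgebraicGeometry.Resolution.MaximalPoints
import HarnessLib

/-!
# Orders at THE generic point of the exceptional divisor of a blowing up along a regular irreducible centre

Topic: `Literature/AlgebraicGeometry/Resolution`. PROVED over the tree; a thin layer joining two tree files.
`BlowupExceptionalGenericOrder.lean` proves, at a MAXIMAL POINT `x′` of `π⁻¹(Y)` over a point `y` with regular local
ring and `𝓘_{Y,y} = 𝔪_y`, that the exceptional divisor computes the `𝔪_y`-adic order: `ord_{x′}(J·𝒪_{X′}) = ord_y(J)`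
and `ord_{x′}((J·𝒪_{X′} : 𝓘_E^b)) = ord_y(J) − b` ([CoP1] = Cossart–Piltant 2008, proof of Prop. 4.2, (10)–(11)).
`ExceptionalDivisorIrreducible.lean` proves that for the blowing up of a regular locally Noetherian scheme along a regular
irreducible nowhere-dense centre `D` the exceptional divisor `π⁻¹(D)` is irreducible (Liu, Thm. 8.1.19 (b)), so it HAS a
generic point `ζ`. Here:
* `IsBlowup.image_preimage_eq_of_isRegular` — `π(π⁻¹(D)) = D` (the pieces `ℙⁿ_{Γ(D ∩ V)}` map onto `D ∩ V`);
* `IsBlowup.isGenericPoint_of_isGenericPoint_preimage` — `π ζ` is the generic point of `D`;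
* `isGenericPoint.mem_maxPoints` (private) — a generic point of a set is a maximal point of it;
* `IsBlowup.idealOrder_comap_genericPoint_preimage`, `IsBlowup.idealOrder_controlledTransform_genericPoint_preimage` —
  **`ord_ζ(J·𝒪_{X′}) = ord_{π ζ}(J)` and `ord_ζ((J·𝒪 : 𝓘_E^b)) = ord_{π ζ}(J) − b` at the generic point `ζ` of
  `π⁻¹(D)`**, for every ideal sheaf `J` — the form consumed along Hironaka's type-(I) tower (ms. 2017 p.14 L2–L6:
  «the pull-back of `J_i` by `π(0)` is `ord_ξ(J_i)`-fold the ideal of the exceptional divisor `H(1)` … reduced to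
  `ord_ξ(J_i) − b_i`-fold at `η(1)`»).

## Sources
* V. Cossart, O. Piltant, J. Algebra 320 (2008) 1051–1082, proof of Prop. 4.2, (10)–(11), p. 8 — through
  `BlowupExceptionalGenericOrder.lean`. [CossartPiltant2008]
* Q. Liu, *Algebraic Geometry and Arithmetic Curves* (2002), Thm. 8.1.19 (b) — through `ExceptionalDivisorIrreducible`.
  [Liu2002]
-/

noncomputable section

open CategoryTheory CategoryTheory.Limits AlgebraicGeometry TopologicalSpace IsLocalRing

namespace Literature.AlgebraicGeometry.Resolution

universe u

open Scheme.IdealSheafData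

/-- A generic point of a subset is a maximal point of it (schemes are T₀). [folklore] -/
private theorem isGenericPoint.mem_maxPoints {X : Scheme.{u}} {S : Set X} {ζ : X} (hζ : IsGenericPoint ζ S) :
    ζ ∈ maxPoints S := by
  refine ⟨hζ.mem, fun η hη hηζ => ?_⟩
  have hζη : ζ ⤳ η := hζ.specializes hη
  exact (hηζ.antisymm hζη).eq

variable {X' X : Scheme.{u}} {π : X' ⟶ X} [IsLocallyNoetherian X] {D : Closeds X}

/-- **`π(π⁻¹(D)) = D`**: the blowing up of a regular locally Noetherian scheme along a regular irreducible
nowhere-dense centre `D` maps the exceptional divisor ONTO the centre (locally `E ≅ ℙⁿ_{Γ(D ∩ V)}` with `n ≥ 0`,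
and `ℙⁿ_R → Spec R` is surjective). [cite: Liu2002, Thm. 8.1.19 (b)] -/
theorem IsBlowup.image_preimage_eq_of_isRegular (hX : Scheme.IsRegular X)
    (hD : Scheme.IsRegular (vanishingIdeal D).subscheme) (hirr : IsIrreducible (D : Set X))
    (hint : interior (D : Set X) = ∅) (hπ : IsBlowup π (vanishingIdeal D)) :
    π '' (π ⁻¹' (D : Set X)) = D := by
  refine le_antisymm (Set.image_preimage_subset _ _) fun x hx => ?_
  have hxs : x ∈ (vanishingIdeal D).support := by
    rw [← SetLike.mem_coe, coe_support_vanishingIdeal]; exact hx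
  obtain ⟨V, hV, hxV, c, f, hf, hqr⟩ := exists_affineOpen_isQuasiRegular_of_mem_support hX hD hxs
  -- at least one generator, by nowhere density
  cases c with
  | zero =>
    exfalso
    haveI : IsAffine (V : Scheme.{u}) := hV
    have h0 : ((vanishingIdeal D).comap V.ι).ideal ⟨⊤, isAffineOpen_top _⟩ = ⊥ := by rw [hf]; simp
    have hVD : (V : Set X) ⊆ (D : Set X) := by
      intro y hy
      have hy' : (⟨y, hy⟩ : ↥(V : Scheme.{u})) ∈ ((vanishingIdeal D).comap V.ι).support :=
        (mem_support_iff_of_mem (I := (vanishingIdeal D).comap V.ι) (U := ⟨⊤, isAffineOpen_top _⟩)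
          (x := (⟨y, hy⟩ : ↥(V : Scheme.{u}))) (Opens.mem_top _)).mpr (by rw [h0]; simp)
      rw [support_comap] at hy'
      have : V.ι ⟨y, hy⟩ ∈ (vanishingIdeal D).support := hy'
      rw [← SetLike.mem_coe, coe_support_vanishingIdeal] at this
      simpa using this
    have : x ∈ interior (D : Set X) := interior_mono hVD (by rw [V.isOpen.interior_eq]; exact hxV)
    rw [hint] at this
    exact this
  | succ n =>
    obtain ⟨-, hsurj⟩ := hπ.isIrreducible_preimage_inter_and_surjOn hirr V hV ⟨x, hx, hxV⟩ f hf hqr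
    obtain ⟨e, he, hex⟩ := hsurj ⟨hx, hxV⟩
    exact ⟨e, he.1, hex⟩

/-- **The generic point of the exceptional divisor lies over the generic point of the centre.**
[cite: Liu2002, Thm. 8.1.19 (b)] -/
theorem IsBlowup.isGenericPoint_of_isGenericPoint_preimage (hX : Scheme.IsRegular X)
    (hD : Scheme.IsRegular (vanishingIdeal D).subscheme) (hirr : IsIrreducible (D : Set X))
    (hint : interior (D : Set X) = ∅) (hπ : IsBlowup π (vanishingIdeal D)) {ζ : X'}
    (hζ : IsGenericPoint ζ (π ⁻¹' (D : Set X))) : IsGenericPoint (π ζ) (D : Set X) := by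
  have h := hζ.image π.continuous
  rwa [hπ.image_preimage_eq_of_isRegular hX hD hirr hint, D.isClosed.closure_eq] at h

/-- **The exceptional divisor computes the order at the centre, at its generic point**: for the blowing up `π` of a
regular locally Noetherian scheme `X` along (the reduced ideal of) a regular irreducible nowhere-dense closed `D`, at the
generic point `ζ` of `π⁻¹(D)` EVERY ideal sheaf `J` has `ord_ζ(J·𝒪_{X′}) = ord_{π ζ}(J)`, `π ζ` being the generic point of
`D` (the maximal-point theorem `IsBlowup.idealOrder_comap_of_mem_maxPoints` at `x′ = ζ`).
[cite: CossartPiltant2008, proof of Prop. 4.2, (10)–(11)] -/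
theorem IsBlowup.idealOrder_comap_genericPoint_preimage (hX : Scheme.IsRegular X)
    (hD : Scheme.IsRegular (vanishingIdeal D).subscheme) (hirr : IsIrreducible (D : Set X))
    (hint : interior (D : Set X) = ∅) (hπ : IsBlowup π (vanishingIdeal D)) {ζ : X'}
    (hζ : IsGenericPoint ζ (π ⁻¹' (D : Set X))) (J : X.IdealSheafData) :
    idealOrder (J.comap π) ζ = idealOrder J (π ζ) := by
  have hgen : IsGenericPoint (π ζ) (D : Set X) := hπ.isGenericPoint_of_isGenericPoint_preimage hX hD hirr hint hζ
  haveI : IsRegularLocalRing (X.presheaf.stalk (π ζ)) := hX (π ζ)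
  have hC : stalkIdeal (vanishingIdeal D) (π ζ) = maximalIdeal (X.presheaf.stalk (π ζ)) :=
    stalkIdeal_vanishingIdeal_eq_maximalIdeal_of_closure_eq (Y := D) hgen.symm
  exact hπ.idealOrder_comap_of_mem_maxPoints (isGenericPoint.mem_maxPoints hζ) hC J

/-- **The controlled transform loses exactly `b` along the exceptional divisor, at its generic point**: same setting,
`X′` locally Noetherian: `ord_ζ((J·𝒪_{X′} : 𝓘_E^b)) = ord_{π ζ}(J) − b` (truncated subtraction in `ℕ∞`) — Hironaka
2017 p.14 L2–L6 «reduced to `ord_ξ(J_i) − b_i`-fold at `η(1)`», along any regular centre.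
[cite: CossartPiltant2008, proof of Prop. 4.2, (10)–(11)] -/
theorem IsBlowup.idealOrder_controlledTransform_genericPoint_preimage [IsLocallyNoetherian X']
    (hX : Scheme.IsRegular X) (hD : Scheme.IsRegular (vanishingIdeal D).subscheme) (hirr : IsIrreducible (D : Set X))
    (hint : interior (D : Set X) = ∅) (hπ : IsBlowup π (vanishingIdeal D)) {ζ : X'}
    (hζ : IsGenericPoint ζ (π ⁻¹' (D : Set X))) (J : X.IdealSheafData) (b : ℕ) :
    idealOrder (controlledTransform π (vanishingIdeal D) J b) ζ = idealOrder J (π ζ) - b := by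
  have hgen : IsGenericPoint (π ζ) (D : Set X) := hπ.isGenericPoint_of_isGenericPoint_preimage hX hD hirr hint hζ
  haveI : IsRegularLocalRing (X.presheaf.stalk (π ζ)) := hX (π ζ)
  have hC : stalkIdeal (vanishingIdeal D) (π ζ) = maximalIdeal (X.presheaf.stalk (π ζ)) :=
    stalkIdeal_vanishingIdeal_eq_maximalIdeal_of_closure_eq (Y := D) hgen.symm
  exact hπ.idealOrder_controlledTransform_of_mem_maxPoints (isGenericPoint.mem_maxPoints hζ) hC J b

end Literature.AlgebraicGeometry.Resolution

end
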